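import Summits.BirchSwinnertonDyer.Rank1Residual.X2.SelmerDivisibleOfNoFiniteSubmodule
import Summits.BirchSwinnertonDyer.Rank1Residual.X2.NonPrimitiveLambdaInvariantOfDatum
import Summits.BirchSwinnertonDyer.Rank1Residual.X2.GreenbergVatsalReductionDatumLine
import Summits.BirchSwinnertonDyer.Rank1Residual.X2.TateLineUnique
import Summits.BirchSwinnertonDyer.Rank1Residual.X2.GreenbergSelmerCountNonsplit
import Literature.NumberTheory.EllipticCurves.BSDSelmerParityDokchitserTowerProofs
import HarnessLib

/-!
# GV Prop. (2.5)/p. 25 at a good ORDINARY prime DERIVED for EVERY datum: uniqueness of Greenberg's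
# reduction line (an inertia-MOVED divisible line is contained in every datum with inertia-trivial
# quotient), and A135 `datumSelmer_divisible_of_finite_torsionBy` at good ordinary `p` from
# Greenberg's Prop. 4.15 (ii), GV Cor. (2.3) (T-GV23L) and `L_𝔭 ⊆ im κ_𝔭` (A111)

HONEST FRAMING (BSD rank-`≤ 1` residual cell `b2b-bsdres`, home
`run/shared/lean/b2b/bsd-rank1-residual/`, unit `b2b-bsdres-eisenstein-p2`, class X2; research route,
no claim beyond stated classes; nothing booked here; labels unchanged): the cell deletes the
COMBINATION-SHAPED residual classes of the rank-`≤ 1` BSD formula from PUBLISHED theorems only and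
TYPES the construction-shaped ones; this is not "finishing BSD". THEOREMS ONLY (no definition, no
named fact, nothing asserted).

## What (gen 31, programme P2 step 4)

Companion of `X2/DatumSelmerDivisibleDerived` (A135 at every odd MULTIPLICATIVE prime) and
`X2/NonPrimitiveSelmerDivisibleGoodOrdinaryDerived` (A116, classical groups at a good ordinary prime).
Here: A135's conclusion at an odd prime of GOOD ORDINARY reduction, for EVERY Greenberg data `L`
above `p` whose `C` is a divisible line (`#(C ∩ E[p^∞][p]) = p`) with inertia-trivial quotient — so
that, together with the multiplicative file, the record is derived at every prime at which the cell
can instantiate it (good ordinary or multiplicative; GV p. 14 "good ordinary or multiplicative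
reduction at `p`").

* §1 **Uniqueness of an inertia-moved line** (`plus_le_of_inertia_moved`,
  `plus_eq_of_inertia_moved`; pure Galois-module algebra on `A = E[p^∞]`): if `C₀` is a `D_v`-stable
  divisible line (`#(C₀ ∩ A[p]) = p`) on which SOME inertia element acts non-trivially, then every
  local datum `C'` with inertia-trivial quotient CONTAINS `C₀` — the subgroup `(x − 1)C₀ ⊆ C' ∩ C₀`
  is divisible and nonzero, hence all of `C₀` (gen 27's `eq_of_le_of_divisible_of_card_eq`) — and
  equals it when `#(C' ∩ A[p]) = p`. (Gen 27's `tateDatum_plus_le_of_inertia` is the Tate-line case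
  via an inertia element with `χ_p = 2`; this version needs only ONE moved point.)
* §2 `data_eq_reductionData_of_inertia`: at a good ordinary `p ≥ 3` every such datum IS Greenberg's
  reduction datum `C = ker(E[p^∞] → Ẽ)` (inertia moves `C[p] ≅ μ_p`: gen 21's `reductionData_hgen`;
  `C` divisible with `#C[p] = p`: `Additive.reductionDatum_divisible`,
  `natCard_reductionData_plus_inf_torsionBy`). GV p. 26: "since we are assuming that `p` is odd, the
  subgroup `C[p]` of `A[p]` is determined by the action of `I_p`".
* §3 **`datumSelmer_divisible_of_finite_torsionBy_goodOrd`** — A135's conclusion with A135's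
  binders at a good ordinary `p` (no "good outside `Σ₀ ∪ {p}`" needed), from `h415` (Prop. 4.15
  (ii): `Sel` divisible at `μ = 0`, `SelmerDivisibleOfNoFiniteSubmodule`), `h23` (T-GV23L: `S^{Σ₀}_A/S_A`
  divisible) and `hGV` (A111: `Sel = S_A`, GV p. 26, tree `Additive.selmerInfty_eq_datumSelmerInfty`).

Registry consequence (for lit / referee, not asserted by Lean): with `DatumSelmerDivisibleDerived`,
A135 is DERIVED at good ordinary `p` ⇐ {Prop. 4.15 (ii), T-GV23L, A111} and at multiplicative `p`
⇐ {Prop. 4.15 (ii), T-GV23L, A137′ (split), A40 (split) / A41 (non-split)}.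

References: R. Greenberg, V. Vatsal, Invent. Math. 142 (2000) = arXiv:math/9906215, §2 Cor. (2.3)
pp. 20–21, Prop. (2.5) p. 23, pp. 25–26; R. Greenberg, LNM 1716 (1999), Prop. 4.15 (ii), §2
pp. 70–75; J.-P. Serre, Invent. Math. 15 (1972) §1.11 Prop. 11 (inertia on the kernel of
reduction).
-/

noncomputable section

open scoped Classical AddSubgroup

namespace Summit.BirchSwinnertonDyer.Rank1Residual.X2.DatumSelmerDivisibleGoodOrdinaryDerived

open NumberField IsDedekindDomain Field WeierstrassCurve
  Literature.NumberTheory.EllipticCurves Literature.NumberTheory.EllipticCurves.GreenbergSelmer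
  Literature.NumberTheory.EllipticCurves.GreenbergVatsal2000
  Literature.NumberTheory.GaloisRepresentations
  Summit.BirchSwinnertonDyer.Rank1Residual.X2.GreenbergVatsalTorsion
  Summit.BirchSwinnertonDyer.Rank1Residual.X2.GreenbergVatsalReductionDatum
  Summit.BirchSwinnertonDyer.Rank1Residual.X2.GreenbergVatsalReductionDatumLine
  Summit.BirchSwinnertonDyer.Rank1Residual.X2.GreenbergVatsalStrictAtP
  Summit.BirchSwinnertonDyer.Rank1Residual.X2.GreenbergSelmerCountNonsplit
  Summit.BirchSwinnertonDyer.Rank1Residual.X2.TrivialZeroStrictInclusionDerived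
  Summit.BirchSwinnertonDyer.Rank1Residual.X2.TateLineUnique
  Summit.BirchSwinnertonDyer.Rank1Residual.X2.NonPrimitiveLambdaInvariantOfDatum
  Summit.BirchSwinnertonDyer.Rank1Residual.X2.SelmerDivisibleOfNoFiniteSubmodule

variable (W : WeierstrassCurve ℚ) [W.IsElliptic] (p : ℕ) [hp : Fact p.Prime]

/-! ## §1. An inertia-moved divisible line lies in every datum with inertia-trivial quotient -/

omit [W.IsElliptic] in
/-- **An inertia-moved divisible line lies in every local datum with inertia-trivial quotient.**
Let `C₀ ≤ A = E[p^∞]` be a `D_v`-stable divisible line (`#(C₀ ∩ A[p]) = p`) and suppose some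
`x ∈ I_v` moves some point of `C₀`. If `C'` is a local datum at `v` with `x•m − m ∈ C'` for all
`x ∈ I_v`, `m ∈ A`, then `C₀ ≤ C'`: the subgroup `(x − 1)C₀` lies in `C' ∩ C₀`, is divisible (image of
a divisible group) and nonzero, so it has `p`-torsion of order `p` and equals `C₀`
(`eq_of_le_of_divisible_of_card_eq`). GV p. 26: "the subgroup `C[p]` of `A[p]` is determined by the
action of `I_p`". [cite: GreenbergVatsal2000, §2 pp. 16, 26] -/
theorem plus_le_of_inertia_moved {v : HeightOneSpectrum (𝓞 ℚ)}
    (N₀ N' : LocalDatum ℚ (W.geomPrimaryTorsion p) v)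
    (h₀div : ∀ c ∈ N₀.plus, ∃ c' ∈ N₀.plus, p • c' = c)
    (h₀card : Nat.card ↥(N₀.plus ⊓ (↥(W.geomPrimaryTorsion p))[(p : ℤ)]) = p)
    (h₀mov : ∃ x ∈ inertia v, ∃ c ∈ N₀.plus, x • c ≠ c)
    (htriv' : ∀ x ∈ inertia v, ∀ m : W.geomPrimaryTorsion p, x • m - m ∈ N'.plus) :
    N₀.plus ≤ N'.plus := by
  set A := W.geomPrimaryTorsion p with hAdef
  obtain ⟨x, hx, c, hc, hxc⟩ := h₀mov
  -- `A` is `p`-primary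
  have hprimA : ∀ m : A, ∃ k : ℕ, p ^ k • m = 0 := fun m ↦ by
    obtain ⟨k, hk⟩ := (AddCommGroup.mem_primaryComponent).1 m.2
    exact ⟨k, Subtype.ext (by rw [AddSubmonoidClass.coe_nsmul, ZeroMemClass.coe_zero]; exact hk)⟩
  -- the endomorphism `f = x − 1` and the subgroup `D = f(C₀)`
  let f : A →+ A := DistribSMul.toAddMonoidHom A x - AddMonoidHom.id A
  have hf : ∀ m : A, f m = x • m - m := fun _ ↦ rfl
  set D : AddSubgroup A := N₀.plus.map f with hDdef
  -- `D ≤ C'` (inertia-trivial quotient) and `D ≤ C₀` (`D_v`-stability)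
  have hDC' : D ≤ N'.plus := by
    rintro _ ⟨m, -, rfl⟩
    rw [hf]; exact htriv' x hx m
  have hDC₀ : D ≤ N₀.plus := by
    rintro _ ⟨m, hm, rfl⟩
    rw [hf]
    obtain ⟨σ, -, rfl⟩ := Subgroup.mem_map.1 hx
    exact N₀.plus.sub_mem (N₀.smul_mem σ hm) hm
  -- `D` is divisible
  have hDdiv : ∀ d ∈ D, ∃ d' ∈ D, p • d' = d := by
    rintro _ ⟨m, hm, rfl⟩
    obtain ⟨m', hm', hpm'⟩ := h₀div m hm
    exact ⟨f m', ⟨m', hm', rfl⟩, by rw [← map_nsmul, hpm']⟩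
  -- `D` has a point of order `p` (it contains `f c ≠ 0` and is `p`-primary)
  have hfc : f c ≠ 0 := by rw [hf]; exact sub_ne_zero.mpr hxc
  have hfcD : f c ∈ D := ⟨c, hc, rfl⟩
  have hex : ∃ k : ℕ, p ^ k • f c = 0 := hprimA (f c)
  set k₀ := Nat.find hex with hk₀def
  have hk₀ : p ^ k₀ • f c = 0 := Nat.find_spec hex
  have hk₀pos : k₀ ≠ 0 := by
    intro h0
    rw [h0, pow_zero, one_smul] at hk₀
    exact hfc hk₀
  obtain ⟨k₁, hk₁⟩ := Nat.exists_eq_succ_of_ne_zero hk₀pos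
  have he_ne : p ^ k₁ • f c ≠ 0 := by
    have := Nat.find_min hex (m := k₁) (by rw [← hk₀def, hk₁]; exact Nat.lt_succ_self _)
    exact this
  have he_mem : p ^ k₁ • f c ∈ D ⊓ A[(p : ℤ)] := by
    refine ⟨D.nsmul_mem hfcD _, AddSubgroup.torsionBy.nsmul_iff.mpr ?_⟩
    rw [← mul_smul, ← pow_succ', ← Nat.succ_eq_add_one, ← hk₁, hk₀]
  -- hence `#(D ∩ A[p]) = p = #(C₀ ∩ A[p])`
  haveI hfinC₀ : Finite ↥(N₀.plus ⊓ A[(p : ℤ)]) := Nat.finite_of_card_ne_zero (by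
    rw [h₀card]; exact hp.out.ne_zero)
  have hle_tors : D ⊓ A[(p : ℤ)] ≤ N₀.plus ⊓ A[(p : ℤ)] := inf_le_inf_right _ hDC₀
  haveI : Finite ↥(D ⊓ A[(p : ℤ)]) := Finite.of_injective _ (AddSubgroup.inclusion_injective hle_tors)
  have hdvd : Nat.card ↥(D ⊓ A[(p : ℤ)]) ∣ p := by
    have h := AddSubgroup.card_dvd_of_le hle_tors
    rwa [h₀card] at h
  have hne1 : Nat.card ↥(D ⊓ A[(p : ℤ)]) ≠ 1 := by
    intro h1
    haveI := (Nat.card_eq_one_iff_unique.mp h1).1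
    have h0 : (⟨p ^ k₁ • f c, he_mem⟩ : ↥(D ⊓ A[(p : ℤ)])) = ⟨0, (D ⊓ A[(p : ℤ)]).zero_mem⟩ :=
      Subsingleton.elim _ _
    exact he_ne (congrArg Subtype.val h0)
  have hcardD : Nat.card ↥(D ⊓ A[(p : ℤ)]) = p :=
    (hp.out.eq_one_or_self_of_dvd _ hdvd).resolve_left hne1
  -- so `D = C₀`, and `C₀ = D ≤ C'`
  have hDeq : D = N₀.plus :=
    eq_of_le_of_divisible_of_card_eq p hDC₀ (fun m _ ↦ hprimA m) hDdiv
      (by rw [h₀card]; exact hp.out.ne_zero) (by rw [hcardD, h₀card])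
  rw [← hDeq]
  exact hDC'

omit [W.IsElliptic] in
/-- **Uniqueness**: under the hypotheses of `plus_le_of_inertia_moved`, if moreover
`#(C' ∩ A[p]) = p` then `C' = C₀` (`C₀ ≤ C'`, `C₀` divisible, equal `p`-torsion orders).
[cite: GreenbergVatsal2000, §2 pp. 16, 26] -/
theorem plus_eq_of_inertia_moved {v : HeightOneSpectrum (𝓞 ℚ)}
    (N₀ N' : LocalDatum ℚ (W.geomPrimaryTorsion p) v)
    (h₀div : ∀ c ∈ N₀.plus, ∃ c' ∈ N₀.plus, p • c' = c)
    (h₀card : Nat.card ↥(N₀.plus ⊓ (↥(W.geomPrimaryTorsion p))[(p : ℤ)]) = p)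
    (h₀mov : ∃ x ∈ inertia v, ∃ c ∈ N₀.plus, x • c ≠ c)
    (htriv' : ∀ x ∈ inertia v, ∀ m : W.geomPrimaryTorsion p, x • m - m ∈ N'.plus)
    (hcard' : Nat.card ↥(N'.plus ⊓ (↥(W.geomPrimaryTorsion p))[(p : ℤ)]) = p) :
    N'.plus = N₀.plus := by
  symm
  refine eq_of_le_of_divisible_of_card_eq p
    (plus_le_of_inertia_moved W p N₀ N' h₀div h₀card h₀mov htriv') ?_ h₀div
    (by rw [hcard']; exact hp.out.ne_zero) (by rw [h₀card, hcard'])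
  intro m _
  obtain ⟨k, hk⟩ := (AddCommGroup.mem_primaryComponent).1 m.2
  exact ⟨k, Subtype.ext (by rw [AddSubmonoidClass.coe_nsmul, ZeroMemClass.coe_zero]; exact hk)⟩

/-! ## §2. At a good ordinary `p ≥ 3`: every datum with inertia-trivial quotient is the reduction datum -/

variable [W.IsGloballyMinimal]

/-- **Inertia moves the reduction line**: at a good ordinary `p ≠ 2` some inertia element moves some
point of `C = ker(E[p^∞] → Ẽ)` (indeed every nonzero point of `C[p] ≅ μ_p` is `τ•c' − c'`,
`reductionData_hgen`; and `C[p] ≠ 0` since `#C[p] = p`). GV p. 26: "the inertia group `I_p` acts on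
`C` by the `p`-cyclotomic character". [cite: GreenbergVatsal2000, §2 p. 26] -/
theorem exists_inertia_smul_ne_reductionData (hp2 : p ≠ 2)
    (hΔ : ¬ (p : ℤ) ∣ minimalDiscriminantInt W) (hord : ¬ (p : ℤ) ∣ W.frobeniusTrace p)
    (v : HeightOneSpectrum (𝓞 ℚ)) (hv : ((p : ℕ) : 𝓞 ℚ) ∈ v.asIdeal) :
    ∃ x ∈ inertia v, ∃ c ∈ (reductionData W p hΔ v hv).plus, x • c ≠ c := by
  set A := W.geomPrimaryTorsion p with hAdef
  -- a nonzero point of `C ∩ A[p]`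
  have hcard := natCard_reductionData_plus_inf_torsionBy W p hΔ hord v hv
  haveI : Finite ↥((reductionData W p hΔ v hv).plus ⊓ A[(p : ℤ)]) :=
    Nat.finite_of_card_ne_zero (by rw [hcard]; exact hp.out.ne_zero)
  have hnt : Nontrivial ↥((reductionData W p hΔ v hv).plus ⊓ A[(p : ℤ)]) := by
    rw [← Finite.one_lt_card_iff_nontrivial, hcard]; exact hp.out.one_lt
  obtain ⟨⟨c, hcC, hcp⟩, hc0⟩ := exists_ne (0 : ↥((reductionData W p hΔ v hv).plus ⊓ A[(p : ℤ)]))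
  have hc0' : c ≠ 0 := fun h ↦ hc0 (Subtype.ext h)
  -- `hgen`: `c = τ•c' − c'` inside `C[p]`
  have hmem : (⟨c, hcp⟩ : ↥(A[(p : ℤ)])) ∈ (torsionData (reductionData W p hΔ) p v hv).plus := by
    change (⟨c, hcp⟩ : ↥(A[(p : ℤ)])) ∈ ((reductionData W p hΔ v hv).plus).addSubgroupOf _
    rw [AddSubgroup.mem_addSubgroupOf]; exact hcC
  obtain ⟨τ, hτ, c', hc', hτc'⟩ := reductionData_hgen W p hp2 hΔ hord v hv ⟨c, hcp⟩ hmem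
  have hc'C : ((c' : ↥(A[(p : ℤ)])) : A) ∈ (reductionData W p hΔ v hv).plus := by
    have h := hc'
    change c' ∈ ((reductionData W p hΔ v hv).plus).addSubgroupOf _ at h
    rwa [AddSubgroup.mem_addSubgroupOf] at h
  refine ⟨τ, hτ, (c' : A), hc'C, fun heq ↦ hc0' ?_⟩
  have h := congrArg (fun z : ↥(A[(p : ℤ)]) ↦ (z : A)) hτc'
  simp only [AddSubgroupClass.coe_sub] at h
  change τ • (c' : A) - (c' : A) = c at h
  rw [heq, sub_self] at h
  exact h.symm

/-- **At a good ordinary `p ≥ 3`, a Greenberg data of `E[p^∞]` with divisible lines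
`#(C ∩ A[p]) = p` and inertia-trivial quotients IS the reduction datum** `C = ker(E[p^∞] → Ẽ)`
(`LocalDatum` is determined by `plus`). Twin of gen 27's `data_eq_of_inertia_of_multiplicative`.
[cite: GreenbergVatsal2000, §2 pp. 14, 26] [cite: GreenbergLNM1716, §2 p. 70] -/
theorem data_eq_reductionData_of_inertia (hp2 : p ≠ 2)
    (hΔ : ¬ (p : ℤ) ∣ minimalDiscriminantInt W) (hord : ¬ (p : ℤ) ∣ W.frobeniusTrace p)
    (L : Data ℚ (W.geomPrimaryTorsion p) p)
    (hcard : ∀ (v : HeightOneSpectrum (𝓞 ℚ)) (hv : ((p : ℕ) : 𝓞 ℚ) ∈ v.asIdeal),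
      Nat.card ↥((L v hv).plus ⊓ (↥(W.geomPrimaryTorsion p))[(p : ℤ)]) = p)
    (htriv : ∀ (v : HeightOneSpectrum (𝓞 ℚ)) (hv : ((p : ℕ) : 𝓞 ℚ) ∈ v.asIdeal),
      ∀ x ∈ inertia v, ∀ m : W.geomPrimaryTorsion p, x • m - m ∈ (L v hv).plus) :
    L = reductionData W p hΔ := by
  funext v hv
  have h := plus_eq_of_inertia_moved W p (reductionData W p hΔ v hv) (L v hv)
    (Additive.reductionDatum_divisible W p hv hΔ hord)
    (natCard_reductionData_plus_inf_torsionBy W p hΔ hord v hv)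
    (exists_inertia_smul_ne_reductionData W p hp2 hΔ hord v hv) (htriv v hv) (hcard v hv)
  cases hL : L v hv with
  | mk plus smul_mem =>
    cases hL' : reductionData W p hΔ v hv with
    | mk plus' smul_mem' =>
      rw [hL, hL'] at h
      change plus = plus' at h
      subst h
      rfl

/-! ## §3. A135 at a good ordinary prime, derived -/

/-- **GV Prop. (2.5)/p. 25 at a good ORDINARY `p ≥ 3`, DERIVED for every datum (registry: A135 at
good ordinary `p` ⇐ {Prop. 4.15 (ii), T-GV23L, A111}).** For `E/ℚ` globally minimal, `p ≠ 2` good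
ordinary, `κ` cyclotomic, Greenberg data `L` above `p` with `C` a divisible line
(`#(C ∩ E[p^∞][p]) = p`) and inertia-trivial quotient, `Σ₀ ∌ p` finite: `S^{Σ₀}_A(ℚ_∞)[p]` finite ⟹
`S^{Σ₀}_A(ℚ_∞) = p · S^{Σ₀}_A(ℚ_∞)`. Route: `L` is the reduction datum (§2); `Sel_E(ℚ_∞)_p = S_A(ℚ_∞)`
(`hGV` = A111, GV p. 26); `Sel` is divisible at `μ = 0` by Prop. 4.15 (ii) (`h415`); `S^{Σ₀}_A/S_A` is
divisible by Cor. (2.3) (`h23`, cotorsion of `S_A` from the finiteness of `S^{Σ₀}_A[p]`,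
`E(ℚ_∞)[p^∞]` finite at an ordinary prime). A135's hypothesis "good reduction outside `Σ₀ ∪ {p}`" is
not needed. [cite: GreenbergVatsal2000, §2 Prop. (2.5) p. 23, p. 25; Cor. (2.3) pp. 20–21; p. 26]
[cite: GreenbergLNM1716, Prop. 4.15 (ii); §2 Props. 2.2, 2.4 (pp. 73–75)] -/
theorem datumSelmer_divisible_of_finite_torsionBy_goodOrd
    (h415 : Greenberg1999.prop415ii_noFiniteSubmodule_of_ordinary_or_multiplicative)
    (h23 : datumSelmer_nonPrimitive_invariants) (hGV : imKummer_ge_greenbergCondition_at_p)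
    (hp2 : p ≠ 2) (hgood : W.HasGoodReductionAtPrime p) (hord : ¬ (p : ℤ) ∣ W.frobeniusTrace p)
    (κ : ZpExtension ℚ p) (hκ : κ.IsCyclotomic)
    (L : Data ℚ (W.geomPrimaryTorsion p) p)
    (hC : ∀ (v : HeightOneSpectrum (𝓞 ℚ)) (hv : ((p : ℕ) : 𝓞 ℚ) ∈ v.asIdeal),
      (∀ c ∈ (L v hv).plus, ∃ c' ∈ (L v hv).plus, p • c' = c) ∧
        Nat.card ↥((L v hv).plus ⊓ (↥(W.geomPrimaryTorsion p))[(p : ℤ)]) = p)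
    (hD : ∀ (v : HeightOneSpectrum (𝓞 ℚ)) (hv : ((p : ℕ) : 𝓞 ℚ) ∈ v.asIdeal),
      ∀ x ∈ inertia v, ∀ m : W.geomPrimaryTorsion p, x • m - m ∈ (L v hv).plus)
    (S₀ : Finset (HeightOneSpectrum (𝓞 ℚ))) (hS₀ : ∀ v ∈ S₀, ((p : ℕ) : 𝓞 ℚ) ∉ v.asIdeal)
    [hfin : Finite ↥(datumSelmerInfty κ (W.geomPrimaryTorsion p) L
        (↑S₀ : Set (HeightOneSpectrum (𝓞 ℚ))) ⊓
      (subgroupH1 κ.kerSubgroup (W.geomPrimaryTorsion p))[(p : ℤ)])] :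
    ∀ s ∈ datumSelmerInfty κ (W.geomPrimaryTorsion p) L (↑S₀ : Set (HeightOneSpectrum (𝓞 ℚ))),
      ∃ t ∈ datumSelmerInfty κ (W.geomPrimaryTorsion p) L (↑S₀ : Set (HeightOneSpectrum (𝓞 ℚ))),
        p • t = s := by
  obtain ⟨γ, hγ⟩ := κ.exists_isTopGenerator
  have hp3 : 3 ≤ p := by have := hp.out.two_le; omega
  have hΔ : ¬ (p : ℤ) ∣ minimalDiscriminantInt W :=
    W.not_dvd_minimalDiscriminantInt_of_hasGoodReductionAtPrime' p hgood
  set A := W.geomPrimaryTorsion p with hAdef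
  set S₀' : Set (HeightOneSpectrum (𝓞 ℚ)) := ↑S₀ with hS₀'
  -- the datum is the reduction datum
  have hLL : L = reductionData W p hΔ :=
    data_eq_reductionData_of_inertia W p hp2 hΔ hord L (fun v hv ↦ (hC v hv).2) hD
  subst hLL
  -- `Sel = S_A` (GV p. 26, A111) and `E(ℚ_∞)[p^∞]` finite
  have hRD : ∀ (v : HeightOneSpectrum (𝓞 ℚ)) (hv : ((p : ℕ) : 𝓞 ℚ) ∈ v.asIdeal),
      (reductionData W p hΔ v hv).greenbergKer κ.kerSubgroup =
        W.localKerOver p κ.kerSubgroup (v.adicCompletion ℚ) :=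
    fun v hv ↦ (localKerOver_eq_greenbergKer_and_strictKer W p κ hGV hκ hv hΔ hord).1.symm
  have hSel : W.selmerInfty κ = datumSelmerInfty κ A (reductionData W p hΔ) ∅ :=
    Additive.selmerInfty_eq_datumSelmerInfty W p κ hp2 hκ (reductionData W p hΔ) hRD
  have hA : Finite (FixedPoints.addSubgroup κ.kerSubgroup A) :=
    W.finite_fixedPoints_kerSubgroup_geomPrimaryTorsion_of_ordinary κ hp2 hgood hord hκ
  -- finiteness of `S_A[p] = Sel[p]`
  have hmono : datumSelmerInfty κ A (reductionData W p hΔ) ∅ ≤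
      datumSelmerInfty κ A (reductionData W p hΔ) S₀' :=
    datumSelmer_mono κ.kerSubgroup A p (reductionData W p hΔ) (Set.empty_subset _)
  haveI hfin0 : Finite ↥(datumSelmerInfty κ A (reductionData W p hΔ) ∅ ⊓
      (subgroupH1 κ.kerSubgroup A)[(p : ℤ)]) :=
    Finite.of_injective _ (AddSubgroup.inclusion_injective (inf_le_inf_right _ hmono))
  haveI : Finite ((↥(W.selmerInfty κ))[(p : ℤ)]) := by
    rw [← finite_inf_torsionBy_iff, hSel]; exact hfin0
  -- `Sel = S_A` is divisible (Prop. 4.15 (ii))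
  have hSA : ∀ s ∈ datumSelmerInfty κ A (reductionData W p hΔ) ∅,
      ∃ t ∈ datumSelmerInfty κ A (reductionData W p hΔ) ∅, p • t = s := by
    rw [← hSel]
    exact selmerInfty_divisible_of_prop415ii_of_finite_torsionBy W p h415 hp3 (Or.inl ⟨hgood, hord⟩)
      hκ hγ
  -- `S^{Σ₀}_A/S_A` is divisible (Cor. (2.3), T-GV23L at the canonical duals)
  obtain ⟨hfg, hXt⟩ :=
    moduleFinite_and_isTorsion_datumDualData_of_finite_torsionBy W κ hγ (reductionData W p hΔ)
      (∅ : Set (HeightOneSpectrum (𝓞 ℚ)))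
  haveI := hfg
  obtain ⟨-, -, -, -, hQ⟩ := h23 W p hp2 κ hκ γ hγ (reductionData W p hΔ) hC hA S₀ hS₀
    (datumDualData W κ (reductionData W p hΔ) ∅ hγ) (datumDualData W κ (reductionData W p hΔ) S₀' hγ)
    hXt
  exact divisible_of_divisible_quotient p hmono hSA hQ

end Summit.BirchSwinnertonDyer.Rank1Residual.X2.DatumSelmerDivisibleGoodOrdinaryDerived

end
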